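import Mathlib
import Summits.ValiantsHypothesis.ValiantsHypothesis.Theses.NewtonUnitEquations
import Summits.ValiantsHypothesis.ValiantsHypothesis.Theorems.NewtonTauWeak.Negative.Zonogon

/-!
# Crux-strategist gen 1 (2026-08-17) — typed statements used in STRATEGY-CENSUS.md (gen 1 sections)

Everything here is a `Prop` over existing declarations (no `sorry`); it is NOT a skeleton and registers no stub.
`vert` = `Theorems.NewtonTauWeak.Negative.vert`, the crux's literal vertex count.
-/

set_option linter.dupNamespace false

noncomputable section

open scoped BigOperators
open MvPolynomial
open Summit.ValiantsHypothesis.ValiantsHypothesis.Theses.NewtonUnitEquations (NewtonTauWeak)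
open Summit.ValiantsHypothesis.ValiantsHypothesis.Theorems.NewtonTauWeak.Negative (vert)

namespace Summit.ValiantsHypothesis.ValiantsHypothesis.Cruxes.NewtonTauWeak.StrategistGen1

/-! ## §Strengthen S-F / §Transfer T-E: the weak real τ-conjecture for SPS (Hrubeš 2020 Thm 3 turns it into the crux). -/

/-- `WeakRealTau`: Koiran's real τ-conjecture for sums of products of sparse univariate real polynomials in the
crux's WEAK shape `2^{am}(kt+2)^b` (the printed conjecture `KoiranRealTauConjecture` has `(k+m+t+2)^c`). OPEN even
for the sub-family of SPS-powers (KPT15, arXiv:1205.1015 p3). -/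
def WeakRealTau : Prop :=
  ∃ a b : ℕ, ∀ (k m t : ℕ) (f : Fin k → Fin m → Polynomial ℝ),
    (∀ i j, (f i j).support.card ≤ t) → (∑ i, ∏ j, f i j) ≠ 0 →
      (∑ i, ∏ j, f i j).roots.toFinset.card ≤ 2 ^ (a * m) * (k * t + 2) ^ b

/-- `HrubesTransfer` (Hrubeš, Eur. J. Comb. 2020 = arXiv:1906.02511, Thm 3 + the real-part expansion
`Re Π_j (u_j + i v_j) = Σ_{|S| even} (−1)^{|S|/2} Π_{j∉S} u_j Π_{j∈S} v_j`): every complex `Σ^kΠ^m` of `t`-sparse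
bivariate polynomials has a nonzero REAL univariate `Σ^{k·2^m}Π^m` of `t`-sparse polynomials whose number of distinct
real roots controls the vertex count: `vert ≤ 16·Z + 4`. A THEOREM in print (D-E piece 1; provable, size L). -/
def HrubesTransfer : Prop :=
  ∀ (k m t : ℕ) (f : Fin k → Fin m → MvPolynomial (Fin 2) ℂ), (∀ i j, (f i j).support.card ≤ t) →
    vert (∑ i, ∏ j, f i j) ≤ 4 ∨
    ∃ g : Fin (k * 2 ^ m) → Fin m → Polynomial ℝ, (∀ i j, (g i j).support.card ≤ t) ∧
      (∑ i, ∏ j, g i j) ≠ 0 ∧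
      vert (∑ i, ∏ j, f i j) ≤ 16 * (∑ i, ∏ j, g i j).roots.toFinset.card + 4

/-- D-E glue (one line of arithmetic once `16·2^{am}(k 2^m t+2)^b + 4 ≤ 2^{(a+b+5)m}(kt+2)^b` is available):
recorded as the statement only. -/
def RealSplit : Prop := HrubesTransfer → WeakRealTau → NewtonTauWeak

/-! ## §Decomposition D-D: the local bound at a common corner (degenerate: equivalent to the crux, `k ↦ k·2^m`). -/

/-- South-west vertex count: extreme points of the hull of the support that are exposed by a direction with both
coordinates negative (the part of the Newton polygon "seen from the corner `0`"). -/
def swVert (p : MvPolynomial (Fin 2) ℂ) : ℕ :=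
  {v ∈ Set.extremePoints ℝ (convexHull ℝ ((fun e : Fin 2 →₀ ℕ => fun i : Fin 2 => ((e i : ℕ) : ℝ)) ''
      (p.support : Set (Fin 2 →₀ ℕ)))) |
    ∃ w : Fin 2 → ℝ, w 0 < 0 ∧ w 1 < 0 ∧
      ∀ e ∈ p.support, ∑ i, w i * ((e i : ℕ) : ℝ) ≤ ∑ i, w i * v i}.ncard

/-- `LocalBound`: the corner-local form of the crux (all products are units with constant term `1`, the scalars sum
to zero so the corner itself is cancelled). Census D-D: `LocalBound ↔ NewtonTauWeak` by inclusion–exclusion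
`Π_{j∈Z}((f_j+1) − 1) = Σ_{S⊆Z} (−1)^{|Z∖S|} Π_{j∈S}(f_j+1)` (`k ↦ k·2^m`, `t ↦ t+1`) and the four reflections. -/
def LocalBound : Prop :=
  ∃ a b : ℕ, ∀ (k m t : ℕ) (u : Fin k → Fin m → MvPolynomial (Fin 2) ℂ) (C : Fin k → ℂ),
    (∀ i j, coeff 0 (u i j) = 1) → (∀ i j, (u i j).support.card ≤ t) → ∑ i, C i = 0 →
      swVert (∑ i, MvPolynomial.C (C i) * ∏ j, u i j) ≤ 2 ^ (a * m) * (k * t + 2) ^ b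

/-! ## §Decomposition D-F: the quasi-polynomial crux-language form (a genuine weakening; KPTT-admissible). -/

/-- `NewtonTauQuasiCrux`: the crux with an extra factor `⌈log₂(m+2)⌉` in the exponent — verbatim the gen-0 strategist's
`NewtonTauQuasi` of `Cruxes/NewtonTauWeak/AdmissibleRetarget.lean` (KPTT-admissible: `2^{(m + log kt)^c}`, `c < 2`).
Not an alias of the crux under padding/grouping (census D-F); its dissociated case is the tree theorem
`dissociated_quasiPoly`. -/
def NewtonTauQuasiCrux : Prop :=
  ∃ a b : ℕ, ∀ (k m t : ℕ) (f : Fin k → Fin m → MvPolynomial (Fin 2) ℂ), (∀ i j, (f i j).support.card ≤ t) →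
    vert (∑ i, ∏ j, f i j) ≤ 2 ^ (a * m) * (k * t + 2) ^ (b * Nat.clog 2 (m + 2))

/-- The upgrade piece of D-F — all difficulty sits here (no amplification mechanism in the plane). -/
def QuasiUpgrade : Prop := NewtonTauQuasiCrux → NewtonTauWeak

/-! ## §Strengthen S-E: the increment form (FALSE for a free `h`: take `h := c − P`). -/

/-- `OneMoreProduct` as first typed (free second summand `h`). Refuted in the census by `h := c − P` with `supp c`
inside `Newt P`: `vert h ≤ m t`, `vert (h + P) = vert c` unbounded. -/
def OneMoreProduct : Prop :=
  ∃ a b : ℕ, ∀ (m t : ℕ) (P : Fin m → MvPolynomial (Fin 2) ℂ) (h : MvPolynomial (Fin 2) ℂ),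
    (∀ j, (P j).support.card ≤ t) →
      vert (h + ∏ j, P j) ≤ vert h + 2 ^ (a * m) * (t + 2) ^ b ∧
      vert h ≤ vert (h + ∏ j, P j) + 2 ^ (a * m) * (t + 2) ^ b

/-! ## Sanity: the crux implies each weakening trivially (quasi), and the local bound is a special case of the crux. -/

theorem newtonTauQuasiCrux_of_newtonTauWeak (h : NewtonTauWeak) : NewtonTauQuasiCrux := by
  obtain ⟨a, b, hab⟩ := h
  refine ⟨a, b, fun k m t f hf => (hab k m t f hf).trans ?_⟩
  apply Nat.mul_le_mul_left
  apply Nat.pow_le_pow_right (by omega)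
  have : 1 ≤ Nat.clog 2 (m + 2) := Nat.clog_pos (by norm_num) (by omega)
  nlinarith

end Summit.ValiantsHypothesis.ValiantsHypothesis.Cruxes.NewtonTauWeak.StrategistGen1
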